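import Literature.Algebra.Homology.TensorObjFinrank
import Mathlib.Algebra.Homology.TotalComplex
import Mathlib.Algebra.Category.ModuleCat.Products
import HarnessLib

/-!
# The Euler characteristic of the total complex of a bounded double complex

Layer `Literature/Algebra/Homology` (pure linear algebra over Mathlib; proved theorems only, 0 definitions, 0 named facts, no instances,
no notation). For a double complex `B` (Mathlib `HomologicalComplex₂ (ModuleCat K) (up ℤ) (up ℤ)`, columns `B.X p`) of finite-dimensional
vector spaces over a division ring, supported in a box `s ×ˢ t` of `Finset`s, with total complex `Tot B = B.total (up ℤ)`
(`(Tot B)ⁿ = ∐_{p+q=n} B^{p,q}`):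

* §1 `finrank_sigmaObj_eq_sum` — for a family `F : α → ModuleCat K` with a categorical coproduct: `dim (∐ F) = Σ_{a ∈ s} dim F a` when the `F a`
  are finite-dimensional and trivial off the `Finset s` (Mathlib `ModuleCat.coprodIsoDirectSum` + row `TensorObjFinrank`'s finite-support
  `finrank_directSum_eq_sum_of_finrank_eq_zero`, BY NAME); `moduleFinite_sigmaObj`;
* §2 `finrank_total_X_eq_sum` — `dim (Tot B)ⁿ = Σ_{(p,q) ∈ s ×ˢ t, p+q=n} dim B^{p,q}` (`(Tot B)ⁿ = B.toGradedObject.mapObj π n` is such a coproduct);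
  `moduleFinite_total_X`; `finrankSupport_total_subset`;
* §3 **`eulerChar_total_eq_sum : χ(Tot B) = Σ_{(p,q) ∈ s ×ˢ t} (−1)^{p+q} dim B^{p,q}`**,
  **`eulerChar_total_eq_sum_columns : χ(Tot B) = Σ_{p ∈ s} (−1)ᵖ χ(B_p)`** (`B_p = B.X p` the `p`-th column) and the row form
  `eulerChar_total_eq_sum_rows`;
* §4 **`homologyEulerChar_total_eq_sum_columns : χ_H(Tot B) = Σ_{p ∈ s} (−1)ᵖ χ_H(B_p)`** — the Euler characteristic of the total complex is computed
  from the vertical cohomology of the columns (the `E₁` page of the column filtration), by row `EulerPoincareFormula` on `Tot B` and on each column;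
  no spectral sequence is used.

DEDUP (searched): Mathlib has no `finrank` ∕ `eulerChar` statement for coproducts, `GradedObject.mapObj` or `HomologicalComplex₂.total`; the tree's
`Algebra/Homology/ExactCoupleEuler` is the page-to-page statement for a derived exact couple and `TensorObjFinrank` the tensor-product special case of
§1 — neither restated. Library only (cell `pub-hodge-ring2`, count-neutral); proves nothing about any crux, route or conjecture.

## References

* C. A. Weibel, *An introduction to homological algebra* (1994), 1.2.6 (total complex), 5.6 (double complexes). [Weibel1994]
* R. Bott, L. W. Tu, *Differential Forms in Algebraic Topology* (1982), §14 (the Euler characteristic is computable from any page). [BottTu1982]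
-/

open CategoryTheory CategoryTheory.Limits

universe v u

namespace Literature.Algebra.Homology.EulerCharTotal

variable {K : Type u} [DivisionRing K]

/-! ### §1 Dimension of a coproduct with finitely many non-zero summands -/

section Sigma

variable {α : Type} (F : α → ModuleCat.{v} K) [HasCoproduct F] [∀ a, Module.Finite K (F a)]

/-- **`dim (∐ F) = Σ_{a ∈ s} dim F a`** for a family of finite-dimensional spaces trivial off the `Finset s` (Mathlib's categorical coproduct in
`ModuleCat` is the direct sum, `ModuleCat.coprodIsoDirectSum`; row `TensorObjFinrank`'s finite-support count). [cite: Weibel1994, 1.2.6] -/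
theorem finrank_sigmaObj_eq_sum (s : Finset α) (hs : ∀ a, a ∉ s → Module.finrank K (F a) = 0) :
    Module.finrank K (∐ F :) = ∑ a ∈ s, Module.finrank K (F a) := by
  classical
  exact (ModuleCat.coprodIsoDirectSum F).toLinearEquiv.finrank_eq.trans
    (TensorObjFinrank.finrank_directSum_eq_sum_of_finrank_eq_zero (fun a => F a) s hs)

/-- `∐ F` is finite-dimensional when the finite-dimensional `F a` are trivial off a `Finset`. [cite: Weibel1994, 1.2.6] -/
theorem moduleFinite_sigmaObj (s : Finset α) (hs : ∀ a, a ∉ s → Module.finrank K (F a) = 0) : Module.Finite K (∐ F :) := by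
  classical
  haveI := TensorObjFinrank.moduleFinite_directSum_of_subsingleton (K := K) (fun a => F a) s fun a ha => Module.finrank_zero_iff.1 (hs a ha)
  exact Module.Finite.equiv (ModuleCat.coprodIsoDirectSum F).toLinearEquiv.symm

end Sigma

/-! ### §2 The terms of the total complex -/

variable (B : HomologicalComplex₂ (ModuleCat.{v} K) (ComplexShape.up ℤ) (ComplexShape.up ℤ)) [B.HasTotal (ComplexShape.up ℤ)]
  [∀ p q, Module.Finite K ((B.X p).X q)] (s t : Finset ℤ) (hB : ∀ p q, p ∉ s ∨ q ∉ t → Module.finrank K ((B.X p).X q) = 0)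

omit [B.HasTotal (ComplexShape.up ℤ)] hB in
/-- The summands `B^{p,q}`, `p + q = n`, of `(Tot B)ⁿ` are finite-dimensional. [cite: Weibel1994, 1.2.6] -/
theorem moduleFinite_mapObjFun (n : ℤ) (i : ComplexShape.π (ComplexShape.up ℤ) (ComplexShape.up ℤ) (ComplexShape.up ℤ) ⁻¹' {n}) :
    Module.Finite K (B.toGradedObject.mapObjFun (ComplexShape.π (ComplexShape.up ℤ) (ComplexShape.up ℤ) (ComplexShape.up ℤ)) n i) := by
  obtain ⟨⟨p, q⟩, _⟩ := i
  exact inferInstanceAs (Module.Finite K ((B.X p).X q))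

include hB

omit [B.HasTotal (ComplexShape.up ℤ)] [∀ p q, Module.Finite K ((B.X p).X q)] in
/-- Off the box `s ×ˢ t` the summands of `(Tot B)ⁿ` have dimension `0`. [cite: Weibel1994, 1.2.6] -/
theorem finrank_mapObjFun_eq_zero (n : ℤ) (i : ComplexShape.π (ComplexShape.up ℤ) (ComplexShape.up ℤ) (ComplexShape.up ℤ) ⁻¹' {n})
    (hi : (i : ℤ × ℤ) ∉ s ×ˢ t) :
    Module.finrank K (B.toGradedObject.mapObjFun (ComplexShape.π (ComplexShape.up ℤ) (ComplexShape.up ℤ) (ComplexShape.up ℤ)) n i) = 0 := by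
  obtain ⟨⟨p, q⟩, h⟩ := i
  exact hB p q (not_and_or.1 fun h' => hi (Finset.mem_product.2 h'))

/-- **`dim (Tot B)ⁿ = Σ_{(p,q) ∈ s ×ˢ t, p + q = n} dim B^{p,q}`** (`(Tot B)ⁿ` is the coproduct of the `B^{p,q}`, `p + q = n`). [cite: Weibel1994, 1.2.6] -/
theorem finrank_total_X_eq_sum (n : ℤ) :
    Module.finrank K ((B.total (ComplexShape.up ℤ)).X n) = ∑ i ∈ s ×ˢ t with i.1 + i.2 = n, Module.finrank K ((B.X i.1).X i.2) := by
  classical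
  haveI := moduleFinite_mapObjFun B n
  refine (finrank_sigmaObj_eq_sum _ ((s ×ˢ t).subtype fun j => j ∈ _ ⁻¹' {n})
    fun i hi => finrank_mapObjFun_eq_zero B s t hB n i fun h => hi (Finset.mem_subtype.2 h)).trans ?_
  refine Finset.sum_bij (fun a _ => (a : ℤ × ℤ)) (fun ⟨⟨p, q⟩, h⟩ ha => Finset.mem_filter.2 ⟨Finset.mem_subtype.1 ha, h⟩)
    (fun _ _ _ _ h => Subtype.ext h) (fun ⟨p, q⟩ hb => ?_) fun ⟨⟨p, q⟩, _⟩ _ => rfl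
  exact ⟨⟨(p, q), (Finset.mem_filter.1 hb).2⟩, Finset.mem_subtype.2 (Finset.mem_filter.1 hb).1, rfl⟩

/-- `(Tot B)ⁿ` is finite-dimensional. [cite: Weibel1994, 1.2.6] -/
theorem moduleFinite_total_X (n : ℤ) : Module.Finite K ((B.total (ComplexShape.up ℤ)).X n) := by
  classical
  haveI := moduleFinite_mapObjFun B n
  exact moduleFinite_sigmaObj _ ((s ×ˢ t).subtype fun j => j ∈ _ ⁻¹' {n})
    fun i hi => finrank_mapObjFun_eq_zero B s t hB n i fun h => hi (Finset.mem_subtype.2 h)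

/-- The rank support of `Tot B` lies in the sumset `{p + q | (p, q) ∈ s ×ˢ t}`. [cite: Weibel1994, 1.2.6] -/
theorem finrankSupport_total_subset :
    GradedObject.finrankSupport (B.total (ComplexShape.up ℤ)).X ⊆ ((s ×ˢ t).image fun i => i.1 + i.2 : Finset (ℤ)) := by
  intro n hn
  by_contra hn'
  refine hn ((finrank_total_X_eq_sum B s t hB n).trans (Finset.sum_eq_zero fun i hi => ?_))
  exact absurd (Finset.mem_image.2 ⟨i, (Finset.mem_filter.1 hi).1, (Finset.mem_filter.1 hi).2⟩) hn'

/-! ### §3 The Euler characteristic of the total complex -/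

/-- **`χ(Tot B) = Σ_{(p,q) ∈ s ×ˢ t} (−1)^{p+q} dim B^{p,q}`**. [cite: Weibel1994, 5.6] [cite: BottTu1982, §14] -/
theorem eulerChar_total_eq_sum :
    (B.total (ComplexShape.up ℤ)).eulerChar = ∑ i ∈ s ×ˢ t, ((i.1 + i.2).negOnePow : ℤ) * (Module.finrank K ((B.X i.1).X i.2) : ℤ) := by
  classical
  rw [(B.total (ComplexShape.up ℤ)).eulerChar_eq_sum_finSet_of_finrankSupport_subset _ (finrankSupport_total_subset B s t hB),
    ← Finset.sum_fiberwise_of_maps_to (s := s ×ˢ t) (t := (s ×ˢ t).image fun i => i.1 + i.2) (g := fun i => i.1 + i.2)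
      (fun i hi => Finset.mem_image_of_mem _ hi)]
  refine Finset.sum_congr rfl fun n _ => ?_
  rw [finrank_total_X_eq_sum B s t hB n, Nat.cast_sum, Finset.mul_sum]
  refine Finset.sum_congr rfl fun i hi => ?_
  rw [← (Finset.mem_filter.1 hi).2]
  rfl

/-- **`χ(Tot B) = Σ_{p ∈ s} (−1)ᵖ χ(B_p)`**: the Euler characteristic of the total complex is the alternating sum of the Euler characteristics of
the columns `B_p = B.X p`. [cite: Weibel1994, 5.6] [cite: BottTu1982, §14] -/
theorem eulerChar_total_eq_sum_columns :
    (B.total (ComplexShape.up ℤ)).eulerChar = ∑ p ∈ s, (p.negOnePow : ℤ) * (B.X p).eulerChar := by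
  rw [eulerChar_total_eq_sum B s t hB, Finset.sum_product]
  refine Finset.sum_congr rfl fun p _ => ?_
  rw [(B.X p).eulerChar_eq_sum_finSet_of_finrankSupport_subset t (fun q hq => by by_contra h; exact hq (hB p q (Or.inr h))),
    Finset.mul_sum]
  refine Finset.sum_congr rfl fun q _ => ?_
  rw [Int.negOnePow_add, Units.val_mul, mul_assoc]
  rfl

/-- **Row form `χ(Tot B) = Σ_{q ∈ t} (−1)^q χ(B^{•,q})`**, the `q`-th row being the column `B.flip.X q` of the flipped double complex.
[cite: Weibel1994, 5.6] [cite: BottTu1982, §14] -/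
theorem eulerChar_total_eq_sum_rows :
    (B.total (ComplexShape.up ℤ)).eulerChar = ∑ q ∈ t, (q.negOnePow : ℤ) * (B.flip.X q).eulerChar := by
  rw [eulerChar_total_eq_sum B s t hB, Finset.sum_product_right]
  refine Finset.sum_congr rfl fun q _ => ?_
  rw [(B.flip.X q).eulerChar_eq_sum_finSet_of_finrankSupport_subset s (fun p hp => by by_contra h; exact hp (hB p q (Or.inl h))),
    Finset.mul_sum]
  refine Finset.sum_congr rfl fun p _ => ?_
  rw [Int.negOnePow_add, Units.val_mul, mul_comm ((Prod.fst (p, q)).negOnePow : ℤ), mul_assoc]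
  rfl

/-! ### §4 From the vertical cohomology of the columns (the `E₁` page) -/

/-- **`χ_H(Tot B) = Σ_{p ∈ s} (−1)ᵖ χ_H(B_p)`**: the homological Euler characteristic of the total complex of a bounded double complex of
finite-dimensional spaces is the alternating sum of the Euler characteristics of the vertical cohomology of its columns (Euler–Poincaré, row
`EulerPoincareFormula`, on `Tot B` and on each column). [cite: BottTu1982, §14] [cite: Weibel1994, 5.6] -/
theorem homologyEulerChar_total_eq_sum_columns :
    (B.total (ComplexShape.up ℤ)).homologyEulerChar = ∑ p ∈ s, (p.negOnePow : ℤ) * (B.X p).homologyEulerChar := by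
  haveI := moduleFinite_total_X B s t hB
  rw [← EulerPoincare.eulerChar_eq_homologyEulerChar _ ((Finset.finite_toSet _).subset (finrankSupport_total_subset B s t hB)),
    eulerChar_total_eq_sum_columns B s t hB]
  refine Finset.sum_congr rfl fun p _ => ?_
  rw [EulerPoincare.eulerChar_eq_homologyEulerChar (B.X p)
    (t.finite_toSet.subset fun q hq => by by_contra h; exact hq (hB p q (Or.inr h)))]

end Literature.Algebra.Homology.EulerCharTotal
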